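import Mathlib.LinearAlgebra.Matrix.NonsingularInverse
import Mathlib.Algebra.Group.Pointwise.Set.Scalar
import Literature.Analysis.ValidatedNumerics.LipschitzMatrixOfJacobian
import HarnessLib

/-!
# Lohner's rearrangement lemma and doubleton enclosures (Mrozek–Zgliczyński 2000, §8)

Topic `Literature/Analysis/ValidatedNumerics`. The SET-ARITHMETIC half of Lohner's method against
the wrapping effect, in the formulation of M. Mrozek and P. Zgliczyński, *Set arithmetic and the
enclosing problem in dynamics*, Ann. Polon. Math. 74 (2000) 237–259, §8 "Shape sensitive
enclosures" (held copy, pp. 249–253), typed verbatim as inclusions between EXACT ranges: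

* §8.1, **weak inverse**: an interval matrix `𝐏*` is a weak inverse of `𝐏₁` if some nonsingular
  selector `P₁ ∈ 𝐏₁` has `P₁⁻¹ ∈ 𝐏*`. Rendered as the hypothesis `∃ P₁ ∈ 𝐏₁, ∃ Q ∈ 𝐐, Q * P₁ = 1`.
  The two printed ways of producing one: a rigorous enclosure `𝐐` of the inverse of a point matrix
  (`{P₁}`; what a verifier computes by exact or interval Gauss–Jordan elimination), and
  "if `𝐏` contains an orthogonal matrix then `𝐏ᵀ` is its weak inverse" (§8.1, and Lemma 8.4 on
  CUBOIDS `c + Q·r`) — `exists_weakInverse_transpose_of_orthogonal`.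
* **Lemma 8.1 (Rearrangement).** If `𝐏*₁` is a weak inverse of `𝐏₁` and
  `r₁ ⊇ (𝐏*₁ · 𝐏) · 𝐫 + 𝐏*₁ · 𝐯` then `𝐏 · 𝐫 + 𝐯 ⊆ 𝐏₁ · r₁` — `rearrangement_subset`, with the
  pointwise form `rearrangement_mem` (for `P ∈ 𝐏, r ∈ 𝐫, v ∈ 𝐯` the vector `P r + v` IS
  `P₁ r₁` for the selector `P₁` and an explicit `r₁ = Q (P r + v) ∈ 𝐫₁`).
* **Lemma 8.3 (Parallelepipeds).** If `f (u) ∈ x₁ + 𝐉 · (u - x) + 𝐞` for `u` in the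
  parallelepiped `x + 𝐁 · 𝐫` (the MEAN VALUE FORM: printed as `f = g + w`, `g(u) ∈ g(x) +
  [J_𝐱 g]·(u - x)` by the set-valued mean value theorem 7.5, `g(x) ∈ x₁ + 𝐱'₁`, `w(u) ∈ 𝐰`; here
  `𝐞` stands for `𝐰 + 𝐱'₁`), `𝐁*₁` is a weak inverse of `𝐁₁` and
  `𝐫₁ ⊇ (𝐁*₁ · (𝐉 · 𝐁)) · 𝐫 + 𝐁*₁ · 𝐞`, then `f (x + 𝐁 · 𝐫) ⊆ x₁ + 𝐁₁ · 𝐫₁`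
  — `parallelepiped_mem` / `image_parallelepiped_subset`.
* **Lemma 8.5 (Doubletons)**, with the remainder part `s = B · 𝐫` a parallelepiped and
  `encl = Rearr₁` of Lemma 8.1 (the combination every Lohner-type integrator uses;
  Kapela–Zgliczyński 2009 §6.4 "Evaluation 4"): for `u = x + C r₀ + B r`, `r₀ ∈ 𝐫₀`, `r ∈ 𝐫`,
  under the same mean value form, `f (u) = x₁ + C₁ r₀ + B₁ r₁` with THE SAME `r₀` and some
  `r₁ ∈ 𝐫₁`, provided
  `𝐫₁ ⊇ (𝐁*₁ · (𝐉 · B)) · 𝐫 + 𝐁*₁ · (𝐞 + (𝐉 · C - C₁) · 𝐫₀)` — `doubleton_mem` /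
  `image_doubleton_subset`. This is, symbol for symbol, the re-parametrisation step of a QR-Lohner
  integrator (`c_{k+1} = x₁`, `C_{k+1} = C₁ ≈ mid(𝐉 C)`, `B_{k+1} = B₁ = Q` of a QR factorisation,
  `r_{k+1} ⊇ Q⁻¹[(P - c_{k+1}) + (𝐉 C_k - C_{k+1}) r₀] + (Q⁻¹ 𝐉 B_k) r_k`).
* **The step chain** (Kapela–Zgliczyński 2009 §6.1: input `[x_k] ⊇ φ(t_k, [x₀])`, output
  `[x_{k+1}] ⊇ φ(t_{k+1}, [x₀])`, with `[x_k] = x_k + C_k [r₀] + [B_k][r̃_k]` of §6.4): iterating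
  `doubleton_mem` along maps `f 0, f 1, …` (the time-`h_k` translations), every orbit started at
  `x 0 + C 0 r₀ + B 0 r` is, at step `k`, of the form `x k + C k r₀ + B k r_k` with the same `r₀`
  and some `r_k ∈ 𝐫 k` — `doubleton_chain`; with `C 0 = 1`, `0 ∈ 𝐫 0` this covers every initial
  point of the box `x 0 + 𝐫₀` (`doubleton_chain_of_mem_box`).
* The mean-value-form hypothesis is DISCHARGED from derivative data by
  `meanValueForm_of_jacobian_enclosure`: if `f = T + ρ` on a convex `W ⊇` the set, `T` is
  differentiable on `W` with Jacobian entries in `[Al, Au]` (`matrixIcc`, an interval matrix) and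
  `ρ (u) ∈ 𝐑`, then `f (u) ∈ x₁ + [Al, Au]·(u - x) + ((T x - x₁) + 𝐑)` — Theorem 7.5 of the paper,
  here imported from `LipschitzMatrixOfJacobian.lean` (Neumaier 1990, Cor. 5.1.5).

## Rendering of interval arithmetic

As in `KrawczykOperator.lean`: an interval vector is a set `𝐫 ⊆ ℝⁿ` (any set — boxes in practice;
the paper's bold `𝐫, 𝐯, 𝐞, 𝐫₀, 𝐫₁` are the arguments `rs, vs, es, rs₀, rs₁` below), an interval
matrix a set of real matrices (`𝐏, 𝐏₁, 𝐏*₁, 𝐉, 𝐁, 𝐁₁` are `Ps, Ps₁, Qs, Js, Bs, Bs₁`), and the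
paper's outward-rounded operations `ˆ·`, `+̂` are replaced by the EXACT ranges (`Set.image2
Matrix.mulVec 𝐀 𝐫 = {M v | M ∈ 𝐀, v ∈ 𝐫}`, pointwise `𝐀 * 𝐁`, `𝐫 + 𝐯`). A correct interval package
computes supersets of these ranges, and every hypothesis of the form "range-expression `⊆ 𝐫₁`" is
monotone under enlarging the left side's evaluation, so a machine check "interval evaluation `⊆ 𝐫₁`"
implies the typed hypothesis. Nothing about floating point, rounding, QR factorisation quality or
the CHOICE of `x₁, C₁, B₁` is assumed: as the paper stresses after Lemma 8.3, correctness holds "for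
any choice of `B₁`"; the choices only affect tightness.

## What is NOT here

The set-valued mean value theorem itself (it is `LipschitzMatrixOfJacobian.lean`); interval
evaluation of rational functions (§6, Thm. 6.2); balls / logarithmic norms (§7.1–7.2); elliptic
sets (§8.5); coverings (§8.6); any statement about how SMALL the enclosures are.

## References

* M. Mrozek, P. Zgliczyński, *Set arithmetic and the enclosing problem in dynamics*, Ann. Polon.
  Math. 74 (2000) 237–259, §8.1 (weak inverse, Rearr₁, Lemma 8.1), §8.2 (Lemma 8.3), §8.3
  (Lemma 8.4), §8.4 (Lemma 8.5). [MrozekZgliczynski2000]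
* T. Kapela, P. Zgliczyński, *A Lohner-type algorithm for control systems and ordinary differential
  inclusions*, DCDS-B 11 (2009) 365–385, arXiv:0712.0910, §6.1 (one step: input/output
  inclusions), §6.4 (rearrangement, Evaluation 4 = doubleton). [KapelaZgliczynski2009]
* R. J. Lohner, *Computation of guaranteed enclosures for the solutions of ordinary initial and
  boundary value problems*, in: Computational Ordinary Differential Equations (Cash, Gladwell,
  eds.), Clarendon Press 1992, 425–435 (the original QR method; cited through the two above).
* A. Neumaier, *Interval Methods for Systems of Equations*, CUP 1990, Cor. 5.1.5. [Neumaier1991]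
-/

noncomputable section

open Set Matrix

open scoped Pointwise

namespace Literature.Analysis.ValidatedNumerics

variable {n : ℕ}

/- Throughout, `image2 mulVec A S = {M *ᵥ v | M ∈ A, v ∈ S}` is the exact range of the
matrix–vector product over a set of matrices `A` and a set of vectors `S` (the paper's `𝐀 · 𝐫`
evaluated WITHOUT rounding); `A * B`, `S + T` are the pointwise product / sum of sets. -/

/-! ### §8.1 Weak inverses and the rearrangement lemma -/

/-- **Weak inverse from an orthogonal selector** (Mrozek–Zgliczyński 2000, §8.1: "if `𝐏` contains
an orthogonal matrix then `𝐏ᵀ` is its weak inverse"; this is the whole content of Lemma 8.4 on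
cuboids `c + Q·r`): if `Q ∈ Qs₁` with `Qᵀ Q = 1` then the set of transposes `{Mᵀ | M ∈ Qs₁}` is a
weak inverse of `Qs₁`, i.e. contains the inverse `Qᵀ` of the nonsingular selector `Q`.
[cite: MrozekZgliczynski2000, §8.1 and Lemma 8.4] -/
theorem exists_weakInverse_transpose_of_orthogonal {Qs₁ : Set (Matrix (Fin n) (Fin n) ℝ)}
    {Q : Matrix (Fin n) (Fin n) ℝ} (hQ : Q ∈ Qs₁) (horth : Qᵀ * Q = 1) :
    ∃ P₁ ∈ Qs₁, ∃ P ∈ Matrix.transpose '' Qs₁, P * P₁ = 1 :=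
  ⟨Q, hQ, Qᵀ, mem_image_of_mem _ hQ, horth⟩

/-- **Weak inverse of a point matrix from a verified inverse enclosure** (Mrozek–Zgliczyński 2000,
§8.1: "to find a weak inverse of a given interval matrix `𝐏` it is enough to find an enclosure of
the inverse matrix of a non-singular selector of `𝐏`"): if `Qs ∋ Q` with `Q P₁ = 1` then `Qs` is a
weak inverse of the singleton `{P₁}`. [cite: MrozekZgliczynski2000, §8.1] -/
theorem exists_weakInverse_singleton {Qs : Set (Matrix (Fin n) (Fin n) ℝ)}
    {P₁ Q : Matrix (Fin n) (Fin n) ℝ} (hQ : Q ∈ Qs) (hQP : Q * P₁ = 1) :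
    ∃ P ∈ ({P₁} : Set (Matrix (Fin n) (Fin n) ℝ)), ∃ Q' ∈ Qs, Q' * P = 1 :=
  ⟨P₁, mem_singleton _, Q, hQ, hQP⟩

/-- **Lemma 8.1 (Rearrangement), pointwise form** (Mrozek–Zgliczyński 2000). Let `Qs` (printed
`𝐏*₁`) be a weak inverse of `Ps₁` (some `P₁ ∈ Ps₁` and `Q ∈ Qs` with `Q P₁ = 1`) and let `rs₁`
contain the exact range `(Qs · Ps) · rs + Qs · vs = Rearr₁(Ps, Ps₁, rs, vs)`. Then for every
`P ∈ Ps`, `r ∈ rs`, `v ∈ vs` there is `r₁ ∈ rs₁` with `P r + v = P₁ r₁` (namely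
`r₁ = Q (P r + v)`); in particular `P r + v ∈ Ps₁ · rs₁`. Proof as printed:
`P r + v = P₁ P₁⁻¹ (P r + v) = P₁ ((P₁⁻¹ P) r + P₁⁻¹ v)`.
[cite: MrozekZgliczynski2000, Lemma 8.1] -/
theorem rearrangement_mem {Ps Ps₁ Qs : Set (Matrix (Fin n) (Fin n) ℝ)}
    {rs vs rs₁ : Set (Fin n → ℝ)}
    (hQ : ∃ P₁ ∈ Ps₁, ∃ Q ∈ Qs, Q * P₁ = 1)
    (hrs₁ : image2 mulVec (Qs * Ps) rs + image2 mulVec Qs vs ⊆ rs₁)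
    {P : Matrix (Fin n) (Fin n) ℝ} (hP : P ∈ Ps) {r v : Fin n → ℝ} (hr : r ∈ rs) (hv : v ∈ vs) :
    ∃ P₁ ∈ Ps₁, ∃ r₁ ∈ rs₁, P *ᵥ r + v = P₁ *ᵥ r₁ := by
  obtain ⟨P₁, hP₁, Q, hQ, hQP⟩ := hQ
  have hPQ : P₁ * Q = 1 := mul_eq_one_comm.mp hQP
  refine ⟨P₁, hP₁, Q *ᵥ (P *ᵥ r + v), hrs₁ ?_, ?_⟩
  · rw [mulVec_add, mulVec_mulVec]
    exact add_mem_add (mem_image2_of_mem (mul_mem_mul hQ hP) hr) (mem_image2_of_mem hQ hv)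
  · rw [mulVec_mulVec, hPQ, one_mulVec]

/-- **Lemma 8.1 (Rearrangement)** (Mrozek–Zgliczyński 2000), set form: if `Qs` (printed `𝐏*₁`) is a
weak inverse of `Ps₁` and `Rearr₁(Ps, Ps₁, rs, vs) = (Qs · Ps) · rs + Qs · vs ⊆ rs₁` (exact ranges;
any outward-rounded interval evaluation contains them), then `Ps · rs + vs ⊆ Ps₁ · rs₁`.
[cite: MrozekZgliczynski2000, Lemma 8.1] -/
theorem rearrangement_subset {Ps Ps₁ Qs : Set (Matrix (Fin n) (Fin n) ℝ)}
    {rs vs rs₁ : Set (Fin n → ℝ)}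
    (hQ : ∃ P₁ ∈ Ps₁, ∃ Q ∈ Qs, Q * P₁ = 1)
    (hrs₁ : image2 mulVec (Qs * Ps) rs + image2 mulVec Qs vs ⊆ rs₁) :
    image2 mulVec Ps rs + vs ⊆ image2 mulVec Ps₁ rs₁ := by
  rintro _ ⟨_, ⟨P, hP, r, hr, rfl⟩, v, hv, rfl⟩
  obtain ⟨P₁, hP₁, r₁, hr₁, h⟩ := rearrangement_mem hQ hrs₁ hP hr hv
  exact ⟨P₁, hP₁, r₁, hr₁, h.symm⟩

/-! ### §8.2–8.3 Parallelepipeds and cuboids -/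

/-- **Lemma 8.3 (Parallelepipeds), pointwise form** (Mrozek–Zgliczyński 2000; Lemma 8.4 for cuboids
is the special case where the weak inverse comes from `exists_weakInverse_transpose_of_orthogonal`).
MEAN VALUE FORM hypothesis `hmv`: for every point `u = x + B r` of the parallelepiped
(`B ∈ Bs`, `r ∈ rs`) there is `J ∈ Js` with `f u - x₁ - J (u - x) ∈ es` (printed: `f = g + w`,
`g(u) ∈ g(x) + J_𝐱 g · (u - x)`, `g(x) ∈ x₁ + 𝐱'₁`, `w(u) ∈ 𝐰`, `es = 𝐰 +̂ 𝐱'₁`). If `Qs` is a weak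
inverse of `Bs₁` and `rs₁ ⊇ Rearr₁(Js · Bs, Bs₁, rs, es) = (Qs · (Js · Bs)) · rs + Qs · es`, then
`f u = x₁ + B₁ r₁` for the selector `B₁ ∈ Bs₁` and some `r₁ ∈ rs₁`.
[cite: MrozekZgliczynski2000, Lemma 8.3] -/
theorem parallelepiped_mem {f : (Fin n → ℝ) → Fin n → ℝ} {x x₁ : Fin n → ℝ}
    {Bs Js Bs₁ Qs : Set (Matrix (Fin n) (Fin n) ℝ)} {rs es rs₁ : Set (Fin n → ℝ)}
    (hmv : ∀ B ∈ Bs, ∀ r ∈ rs, ∃ J ∈ Js, f (x + B *ᵥ r) - x₁ - J *ᵥ (B *ᵥ r) ∈ es)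
    (hQ : ∃ B₁ ∈ Bs₁, ∃ Q ∈ Qs, Q * B₁ = 1)
    (hrs₁ : image2 mulVec (Qs * (Js * Bs)) rs + image2 mulVec Qs es ⊆ rs₁)
    {B : Matrix (Fin n) (Fin n) ℝ} (hB : B ∈ Bs) {r : Fin n → ℝ} (hr : r ∈ rs) :
    ∃ B₁ ∈ Bs₁, ∃ r₁ ∈ rs₁, f (x + B *ᵥ r) = x₁ + B₁ *ᵥ r₁ := by
  obtain ⟨J, hJ, he⟩ := hmv B hB r hr
  -- `f u = x₁ + (J B) r + e` with `e ∈ es`; rearrange `(J B) r + e` by Lemma 8.1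
  obtain ⟨B₁, hB₁, r₁, hr₁, h⟩ :=
    rearrangement_mem (Ps := Js * Bs) hQ hrs₁ (mul_mem_mul hJ hB) hr he
  refine ⟨B₁, hB₁, r₁, hr₁, ?_⟩
  rw [← h, ← mulVec_mulVec]
  abel

/-- **Lemma 8.3 (Parallelepipeds)** (Mrozek–Zgliczyński 2000), set form: under the mean value form
on the parallelepiped `x + Bs · rs`, a weak inverse `Qs` of `Bs₁` and
`rs₁ ⊇ (Qs · (Js · Bs)) · rs + Qs · es`, the image satisfies `f (x + Bs · rs) ⊆ x₁ + Bs₁ · rs₁`.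
[cite: MrozekZgliczynski2000, Lemma 8.3] -/
theorem image_parallelepiped_subset {f : (Fin n → ℝ) → Fin n → ℝ} {x x₁ : Fin n → ℝ}
    {Bs Js Bs₁ Qs : Set (Matrix (Fin n) (Fin n) ℝ)} {rs es rs₁ : Set (Fin n → ℝ)}
    (hmv : ∀ B ∈ Bs, ∀ r ∈ rs, ∃ J ∈ Js, f (x + B *ᵥ r) - x₁ - J *ᵥ (B *ᵥ r) ∈ es)
    (hQ : ∃ B₁ ∈ Bs₁, ∃ Q ∈ Qs, Q * B₁ = 1)
    (hrs₁ : image2 mulVec (Qs * (Js * Bs)) rs + image2 mulVec Qs es ⊆ rs₁) :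
    f '' (x +ᵥ image2 mulVec Bs rs) ⊆ x₁ +ᵥ image2 mulVec Bs₁ rs₁ := by
  rintro _ ⟨u, hu, rfl⟩
  obtain ⟨w, hw, rfl⟩ := mem_vadd_set.mp hu
  obtain ⟨B, hB, r, hr, rfl⟩ := hw
  obtain ⟨B₁, hB₁, r₁, hr₁, h⟩ := parallelepiped_mem hmv hQ hrs₁ hB hr
  rw [vadd_eq_add, h]
  exact vadd_mem_vadd_set (mem_image2_of_mem hB₁ hr₁)

/-! ### §8.4 Doubletons -/

/-- **Lemma 8.5 (Doubletons), pointwise form with the remainder part a parallelepiped and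
`encl = Rearr₁`** (Mrozek–Zgliczyński 2000; Kapela–Zgliczyński 2009 §6.4, Evaluation 4). The set
is the doubleton `x + C · rs₀ + B · rs` (`C`, `B` point matrices). MEAN VALUE FORM hypothesis `hmv`:
for `u = x + C r₀ + B r` there is `J ∈ Js` with `f u - x₁ - J (u - x) ∈ es`. If `Qs` is a weak
inverse of `Bs₁` and
`rs₁ ⊇ (Qs · (Js · B)) · rs + Qs · (es + (Js · C - C₁) · rs₀)`
(printed: `encl(J_𝐱 g, 𝐰 +̂ 𝐱'₁ +̂ 𝐂'₁ ˆ· rs₀, s)` with `(C₁, 𝐂'₁)` a decomposition of `Js ˆ· C`),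
then `f u = x₁ + C₁ r₀ + B₁ r₁` with THE SAME `r₀`, the selector `B₁ ∈ Bs₁` and some `r₁ ∈ rs₁`.
Proof as printed: `f u = x₁ + J C r₀ + J B r + e = x₁ + C₁ r₀ + [(J B) r + (e + (J C - C₁) r₀)]`
and Lemma 8.1 on the bracket. [cite: MrozekZgliczynski2000, Lemma 8.5] -/
theorem doubleton_mem {f : (Fin n → ℝ) → Fin n → ℝ} {x x₁ : Fin n → ℝ}
    {C C₁ B : Matrix (Fin n) (Fin n) ℝ} {Js Bs₁ Qs : Set (Matrix (Fin n) (Fin n) ℝ)}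
    {rs₀ rs es rs₁ : Set (Fin n → ℝ)}
    (hmv : ∀ r₀ ∈ rs₀, ∀ r ∈ rs, ∃ J ∈ Js,
      f (x + C *ᵥ r₀ + B *ᵥ r) - x₁ - J *ᵥ (C *ᵥ r₀ + B *ᵥ r) ∈ es)
    (hQ : ∃ B₁ ∈ Bs₁, ∃ Q ∈ Qs, Q * B₁ = 1)
    (hrs₁ : image2 mulVec (Qs * (Js * {B})) rs
      + image2 mulVec Qs (es + image2 mulVec ((fun J => J * C - C₁) '' Js) rs₀) ⊆ rs₁)
    {r₀ : Fin n → ℝ} (hr₀ : r₀ ∈ rs₀) {r : Fin n → ℝ} (hr : r ∈ rs) :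
    ∃ B₁ ∈ Bs₁, ∃ r₁ ∈ rs₁, f (x + C *ᵥ r₀ + B *ᵥ r) = x₁ + C₁ *ᵥ r₀ + B₁ *ᵥ r₁ := by
  obtain ⟨J, hJ, he⟩ := hmv r₀ hr₀ r hr
  -- the small part `v = e + (J C - C₁) r₀` lies in `es + (Js C - C₁) rs₀`
  have hv : (f (x + C *ᵥ r₀ + B *ᵥ r) - x₁ - J *ᵥ (C *ᵥ r₀ + B *ᵥ r)) + (J * C - C₁) *ᵥ r₀ ∈
      es + image2 mulVec ((fun J => J * C - C₁) '' Js) rs₀ :=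
    add_mem_add he (mem_image2_of_mem (mem_image_of_mem _ hJ) hr₀)
  obtain ⟨B₁, hB₁, r₁, hr₁, h⟩ :=
    rearrangement_mem (Ps := Js * {B}) hQ hrs₁ (mul_mem_mul hJ (mem_singleton B)) hr hv
  refine ⟨B₁, hB₁, r₁, hr₁, ?_⟩
  rw [← h, sub_mulVec, ← mulVec_mulVec, ← mulVec_mulVec, mulVec_add]
  abel

/-- **Lemma 8.5 (Doubletons)** (Mrozek–Zgliczyński 2000), set form: under the hypotheses of
`doubleton_mem`, `f (x + C · rs₀ + B · rs) ⊆ x₁ + C₁ · rs₀ + Bs₁ · rs₁`.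
[cite: MrozekZgliczynski2000, Lemma 8.5] -/
theorem image_doubleton_subset {f : (Fin n → ℝ) → Fin n → ℝ} {x x₁ : Fin n → ℝ}
    {C C₁ B : Matrix (Fin n) (Fin n) ℝ} {Js Bs₁ Qs : Set (Matrix (Fin n) (Fin n) ℝ)}
    {rs₀ rs es rs₁ : Set (Fin n → ℝ)}
    (hmv : ∀ r₀ ∈ rs₀, ∀ r ∈ rs, ∃ J ∈ Js,
      f (x + C *ᵥ r₀ + B *ᵥ r) - x₁ - J *ᵥ (C *ᵥ r₀ + B *ᵥ r) ∈ es)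
    (hQ : ∃ B₁ ∈ Bs₁, ∃ Q ∈ Qs, Q * B₁ = 1)
    (hrs₁ : image2 mulVec (Qs * (Js * {B})) rs
      + image2 mulVec Qs (es + image2 mulVec ((fun J => J * C - C₁) '' Js) rs₀) ⊆ rs₁) :
    f '' (x +ᵥ (image2 mulVec {C} rs₀ + image2 mulVec {B} rs)) ⊆
      x₁ +ᵥ (image2 mulVec {C₁} rs₀ + image2 mulVec Bs₁ rs₁) := by
  rintro _ ⟨u, hu, rfl⟩
  obtain ⟨w, hw, rfl⟩ := mem_vadd_set.mp hu
  obtain ⟨_, ⟨C', hC', r₀, hr₀, rfl⟩, _, ⟨B', hB', r, hr, rfl⟩, rfl⟩ := hw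
  rw [mem_singleton_iff] at hC' hB'
  subst hC' hB'
  obtain ⟨B₁, hB₁, r₁, hr₁, h⟩ := doubleton_mem hmv hQ hrs₁ hr₀ hr
  rw [vadd_eq_add, ← add_assoc, h, add_assoc]
  exact vadd_mem_vadd_set
    (add_mem_add (mem_image2_of_mem (mem_singleton _) hr₀) (mem_image2_of_mem hB₁ hr₁))

/-! ### The step chain (Kapela–Zgliczyński 2009 §6.1, §6.4) -/

/-- **Doubleton chain** (Kapela–Zgliczyński 2009, §6.1 one step "input `[x_k] ⊇ φ(t_k,[x₀])`,
output `[x_{k+1}] ⊇ φ(t_{k+1},[x₀])`" with the representation `[x_k] = x_k + C_k [r₀] +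
[B_k][r̃_k]` of §6.4 Evaluation 4; Mrozek–Zgliczyński 2000, Lemma 8.5 iterated). Data per step
`k`: centre `x k`, point matrices `C k`, `B k`, remainder set `rs k`, slope set `Js k`, remainder
set `es k` of the mean value form of the step map `f k` about `x k` with new centre `x (k+1)`, and a
verified inverse enclosure `Qs k ∋ Q` of the NEXT point matrix, `Q · B (k+1) = 1`. If for every
`k < N` the rearranged range is recorded,
`rs (k+1) ⊇ (Qs k · (Js k · B k)) · rs k + Qs k · (es k + (Js k · C k - C (k+1)) · rs₀)`,
then every orbit `y (k+1) = f k (y k)` started at `y 0 = x 0 + C 0 r₀ + B 0 r` (`r₀ ∈ rs₀`,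
`r ∈ rs 0`) satisfies `y k = x k + C k r₀ + B k r_k` for some `r_k ∈ rs k`, for all `k ≤ N` — with
the SAME `r₀` throughout (the point of the doubleton representation).
[cite: KapelaZgliczynski2009, §6.1 and §6.4 (Evaluation 4)] -/
theorem doubleton_chain {f : ℕ → (Fin n → ℝ) → Fin n → ℝ} {x : ℕ → Fin n → ℝ}
    {C B : ℕ → Matrix (Fin n) (Fin n) ℝ} {Js Qs : ℕ → Set (Matrix (Fin n) (Fin n) ℝ)}
    {rs₀ : Set (Fin n → ℝ)} {rs es : ℕ → Set (Fin n → ℝ)} {N : ℕ}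
    (hmv : ∀ k < N, ∀ r₀ ∈ rs₀, ∀ r ∈ rs k, ∃ J ∈ Js k,
      f k (x k + C k *ᵥ r₀ + B k *ᵥ r) - x (k + 1) - J *ᵥ (C k *ᵥ r₀ + B k *ᵥ r) ∈ es k)
    (hQ : ∀ k < N, ∃ Q ∈ Qs k, Q * B (k + 1) = 1)
    (hrs : ∀ k < N, image2 mulVec (Qs k * (Js k * {B k})) (rs k)
      + image2 mulVec (Qs k) (es k + image2 mulVec ((fun J => J * C k - C (k + 1)) '' Js k) rs₀)
      ⊆ rs (k + 1))
    {y : ℕ → Fin n → ℝ} (hstep : ∀ k < N, y (k + 1) = f k (y k))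
    {r₀ : Fin n → ℝ} (hr₀ : r₀ ∈ rs₀) {r : Fin n → ℝ} (hr : r ∈ rs 0)
    (hy₀ : y 0 = x 0 + C 0 *ᵥ r₀ + B 0 *ᵥ r) :
    ∀ k ≤ N, ∃ rk ∈ rs k, y k = x k + C k *ᵥ r₀ + B k *ᵥ rk := by
  intro k hk
  induction k with
  | zero => exact ⟨r, hr, hy₀⟩
  | succ k ih =>
    have hkN : k < N := Nat.lt_of_succ_le hk
    obtain ⟨rk, hrk, hyk⟩ := ih hkN.le
    obtain ⟨Q, hQk, hQB⟩ := hQ k hkN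
    obtain ⟨B₁, hB₁, r₁, hr₁, h⟩ := doubleton_mem (hmv k hkN)
      (exists_weakInverse_singleton hQk hQB) (hrs k hkN) hr₀ hrk
    rw [mem_singleton_iff] at hB₁
    subst hB₁
    exact ⟨r₁, hr₁, by rw [hstep k hkN, hyk, h]⟩

/-- **Doubleton chain from an initial box** (Kapela–Zgliczyński 2009 §6.1/§6.4; the node-0
convention of a QR-Lohner transcript): if in addition `C 0 = 1` and `0 ∈ rs 0`, then EVERY orbit
started in the box `x 0 + rs₀` — `y 0 = x 0 + r₀` with `r₀ ∈ rs₀` — satisfies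
`y k ∈ x k + C k r₀ + B k · rs k` for all `k ≤ N`; in particular `y k` lies in the `k`-th doubleton
`x k + C k · rs₀ + B k · rs k` (whose hull a transcript records as the claim at time `t_k`).
[cite: KapelaZgliczynski2009, §6.1 and §6.4 (Evaluation 4)] -/
theorem doubleton_chain_of_mem_box {f : ℕ → (Fin n → ℝ) → Fin n → ℝ} {x : ℕ → Fin n → ℝ}
    {C B : ℕ → Matrix (Fin n) (Fin n) ℝ} {Js Qs : ℕ → Set (Matrix (Fin n) (Fin n) ℝ)}
    {rs₀ : Set (Fin n → ℝ)} {rs es : ℕ → Set (Fin n → ℝ)} {N : ℕ}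
    (hmv : ∀ k < N, ∀ r₀ ∈ rs₀, ∀ r ∈ rs k, ∃ J ∈ Js k,
      f k (x k + C k *ᵥ r₀ + B k *ᵥ r) - x (k + 1) - J *ᵥ (C k *ᵥ r₀ + B k *ᵥ r) ∈ es k)
    (hQ : ∀ k < N, ∃ Q ∈ Qs k, Q * B (k + 1) = 1)
    (hrs : ∀ k < N, image2 mulVec (Qs k * (Js k * {B k})) (rs k)
      + image2 mulVec (Qs k) (es k + image2 mulVec ((fun J => J * C k - C (k + 1)) '' Js k) rs₀)
      ⊆ rs (k + 1))
    (hC₀ : C 0 = 1) (hrs0 : (0 : Fin n → ℝ) ∈ rs 0)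
    {y : ℕ → Fin n → ℝ} (hstep : ∀ k < N, y (k + 1) = f k (y k))
    {r₀ : Fin n → ℝ} (hr₀ : r₀ ∈ rs₀) (hy₀ : y 0 = x 0 + r₀) :
    ∀ k ≤ N, y k ∈ x k +ᵥ (image2 mulVec {C k} rs₀ + image2 mulVec {B k} (rs k)) := by
  intro k hk
  have hy₀' : y 0 = x 0 + C 0 *ᵥ r₀ + B 0 *ᵥ 0 := by
    rw [hy₀, hC₀, one_mulVec, mulVec_zero, add_zero]
  obtain ⟨rk, hrk, hyk⟩ := doubleton_chain hmv hQ hrs hstep hr₀ hrs0 hy₀' k hk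
  rw [hyk, add_assoc]
  exact vadd_mem_vadd_set (add_mem_add (mem_image2_of_mem (mem_singleton _) hr₀)
    (mem_image2_of_mem (mem_singleton _) hrk))

/-! ### Discharging the mean value form from a Jacobian enclosure (Theorem 7.5 / Neumaier) -/

/-- **The mean value form from an interval enclosure of the Jacobian** (Mrozek–Zgliczyński 2000,
Theorem 7.5 "set-valued mean value theorem", `f(x + h) ⊂ f(x) + [J_{x+𝐡} f]·h`, combined with the
decomposition `f = g + w` of their (1); the theorem itself is imported as Neumaier 1990 Cor. 5.1.5,
`exists_matrixIcc_meanValue_of_hasFDerivWithinAt`). Let `W` be CONVEX, `T` differentiable within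
`W` with derivative `T' u` whose matrix entries lie in `[Al, Au]` on `W`, let `x ∈ W`, and suppose
every point `u` of a set `S ⊆ W` has `f u - T u ∈ Rs` (the remainder box: for a Taylor-model step
map, the terms evaluated over the rough enclosure). Then for every `u ∈ S` there is
`J ∈ [Al, Au]` with `f u - x₁ - J (u - x) ∈ {T x - x₁} + Rs` — the hypothesis `hmv` of
`parallelepiped_mem` / `doubleton_mem` / `doubleton_chain` with `Js = matrixIcc Al Au` and
`es = {T x - x₁} + Rs` (for the doubleton, `u - x = C r₀ + B r`).
[cite: MrozekZgliczynski2000, Theorem 7.5 and Proposition 7.4] -/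
theorem meanValueForm_of_jacobian_enclosure {f T : (Fin n → ℝ) → Fin n → ℝ}
    {T' : (Fin n → ℝ) → (Fin n → ℝ) →L[ℝ] (Fin n → ℝ)} {W S Rs : Set (Fin n → ℝ)}
    (hW : Convex ℝ W) (hT : ∀ u ∈ W, HasFDerivWithinAt T (T' u) W u)
    {Al Au : Matrix (Fin n) (Fin n) ℝ}
    (hA : ∀ u ∈ W, ∀ i k, Al i k ≤ T' u (Pi.single k 1) i ∧ T' u (Pi.single k 1) i ≤ Au i k)
    {x : Fin n → ℝ} (hx : x ∈ W) (hS : S ⊆ W) (hR : ∀ u ∈ S, f u - T u ∈ Rs) (x₁ : Fin n → ℝ)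
    {u : Fin n → ℝ} (hu : u ∈ S) :
    ∃ J ∈ matrixIcc Al Au, f u - x₁ - J *ᵥ (u - x) ∈ {T x - x₁} + Rs := by
  obtain ⟨M, hM, hTu⟩ := exists_matrixIcc_meanValue_of_hasFDerivWithinAt hW hT hA (hS hu) hx
  refine ⟨M, hM, ?_⟩
  have : f u - x₁ - M *ᵥ (u - x) = (T x - x₁) + (f u - T u) := by rw [hTu]; abel
  rw [this]
  exact add_mem_add (mem_singleton _) (hR u hu)

end Literature.Analysis.ValidatedNumerics

end
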